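import Summits.BirchSwinnertonDyer.Rank1Residual.O6.X3KatoMemberBoundExactCount
import Summits.BirchSwinnertonDyer.Rank1Residual.Additive.N10IsogenyTransport
import HarnessLib

/-!
# O6 / O5: the rank-`0` DescentGlue `KMC_p ⟹ BSD_p` IN HULL CURRENCY — one reading family for L₀, M and U₀,
# no torsion-free member, no Mazur–Kenku walk (cell `bsd-potss`, seat `kmc`, generation 7; part 14e)

The K9 / K8-t′ routes' lower-half cruxes L₀ (`WildLowerHalfRankZero`, `TameLowerHalfRankZero`) have as
two-layer parent the kernel glue `Additive.potGoodLowerHalfRankZero_of_kmc_torsionFree` (part 10,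
p408212): Kato's Main Conjecture at the `p`-TORSION-FREE member of the class (which exists by the
Mazur–Kenku walk, named fact `mazurKenku_exists_cyclic_isogeny`) over the torsion-free readings
(`TorsionFree.DescentCountReading`, `TorsionFree.RealizableOfKMC`, `ReadsTrivialKMC`), then Cassels. With
the EXACT count at an arbitrary member (part 14, `X3KatoMemberBoundExactCount.lean`:
`KatoHull.bsdp_of_kmc` — `KMC_p(W') ⟹ BSD_p(W')` at ANY hull-realised member `W'`, torsion or not) the
torsion-free detour is unnecessary: this file restates the glue over the HULL reading family — Reading
M1♯ `KatoHull.Realizable` (a hull datum is realised at SOME member of every additive potentially good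
class: Kato's member `W_K` with `T_pW_K ≅ V_{ℤ_p}(f)(1)`, Thm. 12.6 + 13.14 — on irreducible rows every
member qualifies, the Galois-stable lattices being homothetic), Reading M3♯ `KatoHull.ExactCountReading`,
the interface lemma `KatoHull.ReadsKMC`, and the named facts Cassels / GZK / modularity — so that ONE
realisation of `IsHullOf` (D-O6-2″) serves L₀, M (`ReducibleKatoMember`), the reducible rows of U₀ and
the member-wise `KMC ⟺ BSD_p` at once, and `mazurKenku_exists_cyclic_isogeny` leaves the glue.
CONDITIONAL over displayed readings / named facts (audit `proof.conditional`); nothing about Kato's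
objects or his Main Conjecture is asserted; no node or item is closed; nothing is booked.

References: [Kato2004Asterisque] 8.3 (p. 181), Thm. 12.4–12.6 (pp. 221–222), Conj. 12.10 (p. 224), 13.14
(p. 234), §14.14 (p. 243), Prop. 14.16 (2) (p. 244); [Wuthrich2014] §3.2 (p. 394); [SilvermanAEC2009]
III.4.12, Rem. III.4.13.2; [Cassels1965ArithmeticVIII]; [Miller2011LMS] Def. 1.1.
-/

set_option autoImplicit false

noncomputable section

open scoped Classical

open WeierstrassCurve Literature.NumberTheory.EllipticCurves
  Literature.NumberTheory.EllipticCurves.ModularForms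
  Literature.NumberTheory.EllipticCurves.Rank1Residual
  Literature.NumberTheory.EllipticCurves.Rank1Residual.Typed
  Literature.NumberTheory.EllipticCurves.IwasawaAlgebra

namespace Summit.BirchSwinnertonDyer.Rank1Residual.Additive

namespace KatoHull

section Readings

variable (IsHullOf : ∀ (W : WeierstrassCurve ℚ) [W.IsElliptic] [W.IsGloballyMinimal] (p : ℕ)
  [Fact p.Prime], KatoHullDescentDatum p → Prop)

/-- **READING M1♯ — a hull datum is realised at some member of every additive potentially good class
(image-free).** For `W/ℚ` globally minimal and `p ≠ 2` additive potentially good there is a globally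
minimal `W'`, `ℚ`-isogenous to `W`, with `T_pW' ≅ V_{ℤ_p}(f)(1)` as Galois lattices (Kato 8.3 with the
integral structure of 6.3; on rows with `W[p]` irreducible every member qualifies, the stable lattices
of `V_pE` being the `p^nT_pE`; on reducible rows it is Kato's member `W_K`, *AEC* III.4.12 / Rem.
III.4.13.2), and for it Kato's §14.14 data with the zeta element in the reflexive hull of `𝐇¹(T)⁰`
(Thm. 12.4, Thm. 12.6 + 13.14, (14.14.1) by the argument of 13.8) form a `KatoHullDescentDatum p` of `W'`.
= part 12's Reading M1 with the reducibility hypothesis dropped. Hypothesis schema; nothing asserted.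
[cite: Kato2004Asterisque, 8.3 (p. 181), Thm. 12.4 (p. 221), Thm. 12.6 (p. 222), 13.14 (p. 234), §14.14 (p. 243)]
[cite: Wuthrich2014, §3.2 (p. 394)] [cite: SilvermanAEC2009, Prop. III.4.12 and Remark III.4.13.2] -/
def Realizable : Prop :=
  ∀ (W : WeierstrassCurve ℚ) [W.IsElliptic] [W.IsGloballyMinimal] (p : ℕ) [Fact p.Prime],
    p ≠ 2 → Addv W p → 0 ≤ padicValRat p W.j →
    ∃ (W' : WeierstrassCurve ℚ) (_ : W'.IsElliptic) (_ : W'.IsGloballyMinimal),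
      IsIsogenous W W' ∧ ∃ D : KatoHullDescentDatum p, IsHullOf W' p D

/-- Reading M1♯ implies part 12's Reading M1 (its reducible case). [cite: Kato2004Asterisque, Thm. 12.6 (p. 222)] -/
theorem memberRealizable_of_realizable (h : Realizable IsHullOf) : MemberRealizable IsHullOf :=
  fun W _ _ p _ hp hadd hj _ ↦ h W p hp hadd hj

end Readings

end KatoHull

variable {IsHullOf : ∀ (W : WeierstrassCurve ℚ) [W.IsElliptic] [W.IsGloballyMinimal] (p : ℕ)
  [Fact p.Prime], KatoHullDescentDatum p → Prop}
variable {KMC : ∀ (W : WeierstrassCurve ℚ) [W.IsElliptic] [W.IsGloballyMinimal] (p : ℕ), Prop}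

/-- **`KMC_p ⟹ BSD_p` ON EVERY ADDITIVE POTENTIALLY GOOD CURVE OF ANALYTIC RANK `0`, IN HULL CURRENCY.**
Granted Reading M1♯ (a hull datum at some isogenous `W'`), Reading M3♯ (the exact count), the interface
lemma `ReadsKMC`, the named facts Cassels / GZK / modularity, and Kato's Main Conjecture at every
additive potentially good curve of analytic rank `0` (hypothesis `hKMC`; KMC is an invariant of the
isogeny class, part 13): `BSDp W p`. Proof: `KMC(W') ⟹ BSD_p(W')` at the realised member
(`KatoHull.bsdp_of_kmc`, any torsion), then Cassels (`N10.bsdp_of_isIsogenous_of_bsdp`). No torsion-free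
member, no Mazur–Kenku. Conditional over displayed hypotheses; nothing asserted.
[cite: Kato2004Asterisque, Conj. 12.10 (p. 224), §14.14 (p. 243), Prop. 14.16 (2) (p. 244)] [cite: Cassels1965ArithmeticVIII] -/
theorem bsdp_rankZero_potGood_of_hullKMC (hRz : KatoHull.Realizable IsHullOf)
    (hC : KatoHull.ExactCountReading IsHullOf) (hK : KatoHull.ReadsKMC IsHullOf KMC)
    (hCassels : bsdRHS_eq_of_isIsogenous) (hGZK : rank_eq_analyticRank_of_analyticRank_le_one)
    (hmod : hasEntireLFunction_rat)
    (hKMC : ∀ (W : WeierstrassCurve ℚ) [W.IsElliptic] [W.IsGloballyMinimal] (p : ℕ) [Fact p.Prime],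
      W.analyticRank = 0 → p ≠ 2 → Addv W p → 0 ≤ padicValRat p W.j → KMC W p)
    (W : WeierstrassCurve ℚ) [W.IsElliptic] [W.IsGloballyMinimal] (p : ℕ) [Fact p.Prime]
    (hr : W.analyticRank = 0) (hp : p ≠ 2) (hadd : Addv W p) (hj : 0 ≤ padicValRat p W.j) :
    BSDp W p := by
  obtain ⟨W', hE', hM', hiso, D, hDof⟩ := hRz W p hp hadd hj
  obtain ⟨hadd', hj'⟩ := Addv.of_isIsogenous_of_padicValRat_j_nonneg (p := p) hadd hj hiso
  have hr' : W'.analyticRank = 0 := by rw [← analyticRank_eq_of_isIsogenous' hiso, hr]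
  have hbsd' : BSDp W' p :=
    KatoHull.bsdp_of_kmc hC hK hGZK hmod hp hadd' hj' hr' hDof (hKMC W' p hr' hp hadd' hj')
  exact N10.bsdp_of_isIsogenous_of_bsdp p hCassels hGZK hmod hiso (by rw [hr]; exact zero_le_one) hbsd'

/-- **The cell's uniform node `PotGoodLowerHalfRankZero` (B4 ∪ B5: the lower half on every odd additive
potentially good `r_an = 0` pair) from KMC_p in hull currency** — the two-layer parent of the L₀ cruxes
of both Kato-descent routes, with the member binder and Mazur–Kenku gone. Conditional; nothing asserted.
[cite: Kato2004Asterisque, Conj. 12.10 (p. 224), Prop. 14.16 (2) (p. 244)] [cite: Cassels1965ArithmeticVIII] -/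
theorem potGoodLowerHalfRankZero_of_hullKMC (hRz : KatoHull.Realizable IsHullOf)
    (hC : KatoHull.ExactCountReading IsHullOf) (hK : KatoHull.ReadsKMC IsHullOf KMC)
    (hCassels : bsdRHS_eq_of_isIsogenous) (hGZK : rank_eq_analyticRank_of_analyticRank_le_one)
    (hmod : hasEntireLFunction_rat)
    (hKMC : ∀ (W : WeierstrassCurve ℚ) [W.IsElliptic] [W.IsGloballyMinimal] (p : ℕ) [Fact p.Prime],
      W.analyticRank = 0 → p ≠ 2 → Addv W p → 0 ≤ padicValRat p W.j → KMC W p) :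
    PotGoodLowerHalfRankZero := by
  intro W _ _ p _ hr hp hadd hj
  have hbsd := bsdp_rankZero_potGood_of_hullKMC hRz hC hK hCassels hGZK hmod hKMC W p hr hp hadd hj
  haveI : Finite W.sha := (hGZK W (by rw [hr]; exact zero_le_one)).2
  obtain ⟨q, hq, hv⟩ := missingPPartAt_of_bsdp W p hbsd
  exact ⟨q, hq, hv.le⟩

end Summit.BirchSwinnertonDyer.Rank1Residual.Additive

namespace Summit.BirchSwinnertonDyer.Rank1Residual

open Additive

variable {IsHullOf : ∀ (W : WeierstrassCurve ℚ) [W.IsElliptic] [W.IsGloballyMinimal] (p : ℕ)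
  [Fact p.Prime], KatoHullDescentDatum p → Prop}
variable {KMC : ∀ (W : WeierstrassCurve ℚ) [W.IsElliptic] [W.IsGloballyMinimal] (p : ℕ), Prop}

/-- **The K9 crux shape `WildLowerHalfRankZero` (`∀ W, r_an = 0 → ClassO6 W 3 → MissingLowerBoundAt W 3`)
from KMC₃ at the wild curves, in hull currency** (M1♯, M3♯, `ReadsKMC`, Cassels, GZK, modularity; no
Mazur–Kenku). Conditional; nothing asserted. [cite: Kato2004Asterisque, Conj. 12.10 (p. 224), Prop. 14.16 (2) (p. 244)]
[cite: Cassels1965ArithmeticVIII] -/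
theorem O6.wildLowerHalfRankZero_of_hullKMC (hRz : KatoHull.Realizable IsHullOf)
    (hC : KatoHull.ExactCountReading IsHullOf) (hK : KatoHull.ReadsKMC IsHullOf KMC)
    (hCassels : bsdRHS_eq_of_isIsogenous) (hGZK : rank_eq_analyticRank_of_analyticRank_le_one)
    (hmod : hasEntireLFunction_rat)
    (hKMC : ∀ (W : WeierstrassCurve ℚ) [W.IsElliptic] [W.IsGloballyMinimal],
      W.analyticRank = 0 → Addv W 3 → 0 ≤ padicValRat 3 W.j → KMC W 3) :
    ∀ (W : WeierstrassCurve ℚ) [W.IsElliptic] [W.IsGloballyMinimal] [Fact (3 : ℕ).Prime],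
      W.analyticRank = 0 → ClassO6 W 3 → MissingLowerBoundAt W 3 := by
  intro W _ _ _ hr hO
  obtain ⟨W', hE', hM', hiso, D, hDof⟩ := hRz W 3 hO.1 hO.2.1 hO.padicValRat_j_nonneg
  obtain ⟨hadd', hj'⟩ :=
    Addv.of_isIsogenous_of_padicValRat_j_nonneg (p := 3) hO.2.1 hO.padicValRat_j_nonneg hiso
  have hr' : W'.analyticRank = 0 := by rw [← analyticRank_eq_of_isIsogenous' hiso, hr]
  have hbsd' : BSDp W' 3 :=
    KatoHull.bsdp_of_kmc hC hK hGZK hmod hO.1 hadd' hj' hr' hDof (hKMC W' hr' hadd' hj')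
  have hbsd : BSDp W 3 :=
    N10.bsdp_of_isIsogenous_of_bsdp 3 hCassels hGZK hmod hiso (by rw [hr]; exact zero_le_one) hbsd'
  haveI : Finite W.sha := (hGZK W (by rw [hr]; exact zero_le_one)).2
  obtain ⟨q, hq, hv⟩ := missingPPartAt_of_bsdp W 3 hbsd
  exact ⟨q, hq, hv.le⟩

/-- **The K8-t′ crux shape `TameLowerHalfRankZero` (`∀ W p, r_an = 0 → p ≠ 2 → Addv → SubTprime →
MissingLowerBoundAt W p`) from KMC_p, in hull currency** (via the uniform node). Conditional; nothing
asserted. [cite: Kato2004Asterisque, Conj. 12.10 (p. 224), Prop. 14.16 (2) (p. 244)] [cite: Cassels1965ArithmeticVIII] -/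
theorem O6.tameLowerHalfRankZero_of_hullKMC (hRz : KatoHull.Realizable IsHullOf)
    (hC : KatoHull.ExactCountReading IsHullOf) (hK : KatoHull.ReadsKMC IsHullOf KMC)
    (hCassels : bsdRHS_eq_of_isIsogenous) (hGZK : rank_eq_analyticRank_of_analyticRank_le_one)
    (hmod : hasEntireLFunction_rat)
    (hKMC : ∀ (W : WeierstrassCurve ℚ) [W.IsElliptic] [W.IsGloballyMinimal] (p : ℕ) [Fact p.Prime],
      W.analyticRank = 0 → p ≠ 2 → Addv W p → 0 ≤ padicValRat p W.j → KMC W p) :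
    ∀ (W : WeierstrassCurve ℚ) [W.IsElliptic] [W.IsGloballyMinimal] (p : ℕ) [Fact p.Prime],
      W.analyticRank = 0 → p ≠ 2 → Addv W p → SubTprime W p → MissingLowerBoundAt W p := by
  intro W _ _ p _ hr hp hadd hT
  have hO5 : ClassO5 W p := ⟨hp, hadd, Or.inr hT⟩
  exact potGoodLowerHalfRankZero_of_hullKMC hRz hC hK hCassels hGZK hmod hKMC W p hr hp hadd
    hO5.padicValRat_j_nonneg

end Summit.BirchSwinnertonDyer.Rank1Residual

end
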